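import Summits.CriticalPhenomena.PercolationContinuityZ3.Theorems.Transplant.GrigorchukPowerLaceOperatorsWeights
import Mathlib.Analysis.SpecificLimits.Normed
import HarnessLib

/-!
# W4 S3b-β «ResolventIdentity» (first file): `Ψ = 1 + ρ(K)` is a unit for `‖K‖₁ < 1`; the lace kernel's renewal identity makes `X = Ψ⁻¹ − p·A` the
# TWO-SIDED inverse of the two-point operator `T`, self-adjoint, with `0 ≤ ⟪η, Xη⟫` and `⟪η, Xη⟫ ≥ ‖T‖⁻¹‖η‖²`; hence `Ψ† = Ψ` and the lace kernel is inversion-symmetric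

Definition + proof file (`--kind definition`, `--supports stmt-CriticalPhenomena-4575 --as helper`), lane `prim-bschramm`, seat `prim-bschramm-gen-1` gen 13 (GEN pen);
item β of P3-NILPOTENT §39 (39.1) (design desk p3 g43; HOLD/GATED on α ACCEPTED + the lead's line — typed ahead, filed only when opened), this is β₁ = (β1)–(β4):
`PsiOp`, `isUnit_PsiOp`, `inner_PsiOp_ge`, `inner_inverse_PsiOp_nonneg`; `XOp`, `XOp_mul_twoPointOp` (left inverse, from α (L5)); `twoPointOp_mul_XOp`,
`adjoint_XOp`, `isUnit_twoPointOp`, `inverse_twoPointOp`, `inner_XOp_nonneg`, `norm_sq_le_norm_mul_inner` (‖Th‖² ≤ ‖T‖⟪h,Th⟫ for `T ≽ 0` self-adjoint),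
`inner_XOp_ge`; `adjoint_PsiOp`, `kernelOp_injective`, `IsLaceKernel.inv_symm` (`K(x⁻¹) = K(x)`).  Serves S3b′ `stub_fBoot_le_of_laceBound` (v1.8 :80) via
P3-NILPOTENT §37.2 (i); ASSERTS NOTHING about it and nothing about S3a′ (every statement is conditional on `IsLaceKernel k p K`, whose existence is NOT claimed).
builds on p205010 (kernel theorem, internal audit signed; external expert review pending) — nothing here uses p205010.  No instance, no notation, no sorry.
[cite: HeydenreichVanDerHofstad2017, Lemma 8.11–8.12 ((8.4.7), (8.4.14)–(8.4.29))] [cite: HaraSlade1990, §4 (the lace expansion identity and its inversion)]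
-/

noncomputable section

namespace Summit.CriticalPhenomena.PercolationContinuityZ3.Theorems.Transplant

namespace Grigorchuk

namespace NcHaraSlade

open SimpleGraph Literature.Probability.Percolation Literature.Barriers.CriticalPhenomena
open scoped ENNReal Classical InnerProductSpace

variable {k : ℕ}

/-! ## §1 (β1) `Ψ = 1 + ρ(K)` is a unit for `‖K‖₁ < 1` -/

/-- **`PsiOp K = 1 + ρ(K)`** (`= ρ(δ + K)`, the operator of `Ψ = δ + K`). [cite: HeydenreichVanDerHofstad2017, §8.4 ((8.4.7))] -/
def PsiOp (K : GPow k → ℝ) : lp (fun _ : GPow k => ℝ) 2 →L[ℝ] lp (fun _ : GPow k => ℝ) 2 := 1 + kernelOp K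

/-- `δ ∈ ℓ¹`. [folklore] -/
theorem summable_abs_deltaFun : Summable fun g : GPow k => |deltaFun k g| :=
  summable_of_ne_finset_zero (s := {1}) fun g hg => by rw [Finset.mem_singleton] at hg; rw [deltaFun_of_ne_one hg, abs_zero]

/-- `δ + K ∈ ℓ¹` for `K ∈ ℓ¹`. [folklore] -/
theorem summable_abs_delta_add {K : GPow k → ℝ} (hK : Summable fun x => |K x|) : Summable fun g => |deltaFun k g + K g| :=
  (summable_abs_deltaFun.add hK).of_nonneg_of_le (fun _ => abs_nonneg _) fun _ => abs_add_le _ _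

/-- `PsiOp K = ρ(δ + K)`. [folklore] -/
theorem PsiOp_eq_kernelOp {K : GPow k → ℝ} (hK : Summable fun x => |K x|) : PsiOp K = kernelOp (fun g => deltaFun k g + K g) := by
  rw [PsiOp, kernelOp_add summable_abs_deltaFun hK, kernelOp_deltaFun]

/-- **`Ψ` is a unit when `‖K‖₁ < 1`** (Neumann series in the Banach algebra `ℓ² →L[ℝ] ℓ²`; `‖ρ(K)‖ ≤ ‖K‖₁`). [cite: HeydenreichVanDerHofstad2017, Lemma 8.11] -/
theorem isUnit_PsiOp {K : GPow k → ℝ} (hK : Summable fun x => |K x|) (hK1 : ∑' x, |K x| < 1) : IsUnit (PsiOp K) := by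
  have h : ‖-kernelOp K‖ < 1 := by rw [norm_neg]; exact (norm_kernelOp_le hK).trans_lt hK1
  have hu := isUnit_one_sub_of_norm_lt_one h
  rwa [sub_neg_eq_add] at hu

/-- **`⟪η, Ψ η⟫ ≥ (1 − ‖K‖₁) ‖η‖²`**. [cite: HeydenreichVanDerHofstad2017, Lemma 8.11] -/
theorem inner_PsiOp_ge {K : GPow k → ℝ} (hK : Summable fun x => |K x|) (η : lp (fun _ : GPow k => ℝ) 2) :
    (1 - ∑' x, |K x|) * ‖η‖ ^ 2 ≤ ⟪η, PsiOp K η⟫_ℝ := by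
  have h1 : |⟪η, kernelOp K η⟫_ℝ| ≤ (∑' x, |K x|) * ‖η‖ ^ 2 := by
    calc |⟪η, kernelOp K η⟫_ℝ| ≤ ‖η‖ * ‖kernelOp K η‖ := abs_real_inner_le_norm _ _
      _ ≤ ‖η‖ * (‖kernelOp K‖ * ‖η‖) := mul_le_mul_of_nonneg_left ((kernelOp K).le_opNorm η) (norm_nonneg _)
      _ ≤ ‖η‖ * ((∑' x, |K x|) * ‖η‖) := mul_le_mul_of_nonneg_left (mul_le_mul_of_nonneg_right (norm_kernelOp_le hK) (norm_nonneg _)) (norm_nonneg _)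
      _ = (∑' x, |K x|) * ‖η‖ ^ 2 := by ring
  have h2 : ⟪η, PsiOp K η⟫_ℝ = ‖η‖ ^ 2 + ⟪η, kernelOp K η⟫_ℝ := by
    rw [PsiOp, add_apply, one_apply_eq_self, inner_add_right, real_inner_self_eq_norm_sq]
  rw [h2]
  have := neg_abs_le ⟪η, kernelOp K η⟫_ℝ
  linarith

/-- `Ψ (Ψ⁻¹ η) = η` for the unit `Ψ`. [folklore] -/
theorem PsiOp_inverse_apply {K : GPow k → ℝ} (hu : IsUnit (PsiOp K)) (η : lp (fun _ : GPow k => ℝ) 2) :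
    PsiOp K (Ring.inverse (PsiOp K) η) = η := by
  rw [← mul_apply_eq_comp, Ring.mul_inverse_cancel _ hu, one_apply_eq_self]

/-- **`0 ≤ ⟪η, Ψ⁻¹ η⟫`** for `‖K‖₁ < 1` (`⟪η, Ψ⁻¹η⟫ = ⟪Ψh, h⟫ = ⟪h, Ψh⟫ ≥ (1 − ‖K‖₁)‖h‖²`, `h = Ψ⁻¹η`). [cite: HeydenreichVanDerHofstad2017, Lemma 8.11] -/
theorem inner_inverse_PsiOp_nonneg {K : GPow k → ℝ} (hK : Summable fun x => |K x|) (hK1 : ∑' x, |K x| < 1) (η : lp (fun _ : GPow k => ℝ) 2) :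
    0 ≤ ⟪η, Ring.inverse (PsiOp K) η⟫_ℝ := by
  set h := Ring.inverse (PsiOp K) η with hh
  have hη : PsiOp K h = η := PsiOp_inverse_apply (isUnit_PsiOp hK hK1) η
  calc (0 : ℝ) ≤ (1 - ∑' x, |K x|) * ‖h‖ ^ 2 := mul_nonneg (by linarith) (sq_nonneg _)
    _ ≤ ⟪h, PsiOp K h⟫_ℝ := inner_PsiOp_ge hK h
    _ = ⟪PsiOp K h, h⟫_ℝ := real_inner_comm (PsiOp K h) h
    _ = ⟪η, h⟫_ℝ := by rw [hη]

/-! ## §2 (β2) `X = Ψ⁻¹ − p·A` is a LEFT inverse of `T` (the renewal identity of α (L5)) -/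

/-- **`XOp k p K = Ψ⁻¹ − p • A`** (`= Ψ⁻¹ − λP` with `λ = 4kp`, `P = (4k)⁻¹A`; total: `Ring.inverse` is `0` off units). [cite: HeydenreichVanDerHofstad2017, Lemma 8.12 ((8.4.14))] -/
def XOp (k : ℕ) (p : unitInterval) (K : GPow k → ℝ) : lp (fun _ : GPow k => ℝ) 2 →L[ℝ] lp (fun _ : GPow k => ℝ) 2 :=
  Ring.inverse (PsiOp K) - (p : ℝ) • adjOp k

/-- The renewal identity factored: `T = Ψ (1 + p A T)`. [cite: HeydenreichVanDerHofstad2017, §6.2] -/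
theorem twoPointOp_eq_PsiOp_mul {p : unitInterval} {K : GPow k → ℝ} (hK : IsLaceKernel k p K) (hp : (p : ℝ) < pcR k) :
    twoPointOp k p = PsiOp K * (1 + (p : ℝ) • (adjOp k * twoPointOp k p)) := by
  rw [PsiOp_eq_kernelOp hK.summable_abs, mul_add, mul_one, mul_smul_comm, ← mul_assoc]
  exact twoPointOp_eq_renewal hK hp

/-- **`X T = 1`**: `X = Ψ⁻¹ − p·A` is a left inverse of `T` (`‖K‖₁ < 1`, `p < p_c`). [cite: HeydenreichVanDerHofstad2017, Lemma 8.12] -/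
theorem XOp_mul_twoPointOp {p : unitInterval} {K : GPow k → ℝ} (hK : IsLaceKernel k p K) (hp : (p : ℝ) < pcR k) (hK1 : ∑' x, |K x| < 1) :
    XOp k p K * twoPointOp k p = 1 := by
  have hu := isUnit_PsiOp hK.summable_abs hK1
  have hT := twoPointOp_eq_PsiOp_mul hK hp
  rw [XOp, sub_mul, smul_mul_assoc]
  nth_rewrite 1 [hT]
  rw [← mul_assoc, Ring.inverse_mul_cancel _ hu, one_mul]
  exact add_sub_cancel_right 1 _

/-! ## §3 (β3) Two-sided: `T X = 1`, `X† = X`, positivity and the lower bound `⟪η, Xη⟫ ≥ ‖T‖⁻¹‖η‖²` -/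

/-- `(A B)† = B† A†` in the operator ring. [folklore] -/
theorem adjoint_mul (A B : lp (fun _ : GPow k => ℝ) 2 →L[ℝ] lp (fun _ : GPow k => ℝ) 2) :
    ContinuousLinearMap.adjoint (A * B) = ContinuousLinearMap.adjoint B * ContinuousLinearMap.adjoint A := by
  rw [← ContinuousLinearMap.star_eq_adjoint, star_mul, ContinuousLinearMap.star_eq_adjoint, ContinuousLinearMap.star_eq_adjoint]

/-- `T X† = 1` (adjoint of `X T = 1`, `T† = T`). [folklore] -/
theorem twoPointOp_mul_adjoint_XOp {p : unitInterval} {K : GPow k → ℝ} (hK : IsLaceKernel k p K) (hp : (p : ℝ) < pcR k) (hK1 : ∑' x, |K x| < 1) :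
    twoPointOp k p * ContinuousLinearMap.adjoint (XOp k p K) = 1 := by
  have h := congrArg ContinuousLinearMap.adjoint (XOp_mul_twoPointOp hK hp hK1)
  rwa [adjoint_mul, adjoint_twoPointOp hp, ContinuousLinearMap.adjoint_one] at h

/-- **`X† = X`** (`X† = (X T) X† = X (T X†) = X`). [cite: HeydenreichVanDerHofstad2017, Lemma 8.12] -/
theorem adjoint_XOp {p : unitInterval} {K : GPow k → ℝ} (hK : IsLaceKernel k p K) (hp : (p : ℝ) < pcR k) (hK1 : ∑' x, |K x| < 1) :
    ContinuousLinearMap.adjoint (XOp k p K) = XOp k p K := by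
  have h1 := XOp_mul_twoPointOp hK hp hK1
  have h2 := twoPointOp_mul_adjoint_XOp hK hp hK1
  calc ContinuousLinearMap.adjoint (XOp k p K) = (XOp k p K * twoPointOp k p) * ContinuousLinearMap.adjoint (XOp k p K) := by rw [h1, one_mul]
    _ = XOp k p K * (twoPointOp k p * ContinuousLinearMap.adjoint (XOp k p K)) := mul_assoc _ _ _
    _ = XOp k p K := by rw [h2, mul_one]

/-- **`T X = 1`**: `X` is a two-sided inverse of `T`. [cite: HeydenreichVanDerHofstad2017, Lemma 8.12] -/
theorem twoPointOp_mul_XOp {p : unitInterval} {K : GPow k → ℝ} (hK : IsLaceKernel k p K) (hp : (p : ℝ) < pcR k) (hK1 : ∑' x, |K x| < 1) :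
    twoPointOp k p * XOp k p K = 1 := by
  have h := twoPointOp_mul_adjoint_XOp hK hp hK1
  rwa [adjoint_XOp hK hp hK1] at h

/-- **`T` is a unit** below `p_c` whenever a lace kernel with `‖K‖₁ < 1` exists. [cite: HeydenreichVanDerHofstad2017, Lemma 8.12] -/
theorem isUnit_twoPointOp {p : unitInterval} {K : GPow k → ℝ} (hK : IsLaceKernel k p K) (hp : (p : ℝ) < pcR k) (hK1 : ∑' x, |K x| < 1) :
    IsUnit (twoPointOp k p) :=
  isUnit_iff_exists.2 ⟨XOp k p K, twoPointOp_mul_XOp hK hp hK1, XOp_mul_twoPointOp hK hp hK1⟩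

/-- **`T⁻¹ = X = Ψ⁻¹ − p·A`**. [cite: HeydenreichVanDerHofstad2017, Lemma 8.12 ((8.4.14))] -/
theorem inverse_twoPointOp {p : unitInterval} {K : GPow k → ℝ} (hK : IsLaceKernel k p K) (hp : (p : ℝ) < pcR k) (hK1 : ∑' x, |K x| < 1) :
    Ring.inverse (twoPointOp k p) = XOp k p K := by
  have hu := isUnit_twoPointOp hK hp hK1
  calc Ring.inverse (twoPointOp k p) = Ring.inverse (twoPointOp k p) * (twoPointOp k p * XOp k p K) := by rw [twoPointOp_mul_XOp hK hp hK1, mul_one]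
    _ = (Ring.inverse (twoPointOp k p) * twoPointOp k p) * XOp k p K := (mul_assoc _ _ _).symm
    _ = XOp k p K := by rw [Ring.inverse_mul_cancel _ hu, one_mul]

/-- **`0 ≤ ⟪η, X η⟫`** (`η = T h`, `⟪Th, h⟫ = ⟪h, Th⟫ ≥ 0` by α `inner_twoPointOp_nonneg`). [cite: HeydenreichVanDerHofstad2017, Lemma 8.12] -/
theorem inner_XOp_nonneg {p : unitInterval} {K : GPow k → ℝ} (hK : IsLaceKernel k p K) (hp : (p : ℝ) < pcR k) (hK1 : ∑' x, |K x| < 1)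
    (η : lp (fun _ : GPow k => ℝ) 2) : 0 ≤ ⟪η, XOp k p K η⟫_ℝ := by
  set h := XOp k p K η with hh
  have hη : twoPointOp k p h = η := by rw [hh, ← mul_apply_eq_comp, twoPointOp_mul_XOp hK hp hK1, one_apply_eq_self]
  calc (0 : ℝ) ≤ ⟪h, twoPointOp k p h⟫_ℝ := inner_twoPointOp_nonneg hp h
    _ = ⟪twoPointOp k p h, h⟫_ℝ := real_inner_comm _ _
    _ = ⟪η, h⟫_ℝ := by rw [hη]

/-- **`‖A h‖² ≤ ‖A‖ ⟪h, A h⟫` for a positive self-adjoint bounded operator** (Cauchy–Schwarz for the form `⟪·, A ·⟫`, run on `h − ‖A‖⁻¹ A h`). [folklore] -/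
theorem norm_sq_le_norm_mul_inner (A : lp (fun _ : GPow k => ℝ) 2 →L[ℝ] lp (fun _ : GPow k => ℝ) 2) (hsa : ContinuousLinearMap.adjoint A = A)
    (hpos : ∀ η, 0 ≤ ⟪η, A η⟫_ℝ) (h : lp (fun _ : GPow k => ℝ) 2) : ‖A h‖ ^ 2 ≤ ‖A‖ * ⟪h, A h⟫_ℝ := by
  by_cases hA : ‖A‖ = 0
  · have hA0 : A = 0 := norm_eq_zero.1 hA
    simp [hA0]
  have hApos : 0 < ‖A‖ := lt_of_le_of_ne (norm_nonneg _) (Ne.symm hA)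
  set t : ℝ := ‖A‖⁻¹ with ht
  have ht0 : 0 < t := inv_pos.2 hApos
  have htA : t * ‖A‖ = 1 := inv_mul_cancel₀ hA
  set b : ℝ := ‖A h‖ ^ 2 with hb
  set c : ℝ := ⟪h, A h⟫_ℝ with hc
  set a : ℝ := ⟪A h, A (A h)⟫_ℝ with ha
  have hAA : ⟪h, A (A h)⟫_ℝ = b := by rw [← ContinuousLinearMap.adjoint_inner_left, hsa, real_inner_self_eq_norm_sq]
  have hab : a ≤ ‖A‖ * b := by
    calc a ≤ |a| := le_abs_self a
      _ ≤ ‖A h‖ * ‖A (A h)‖ := abs_real_inner_le_norm _ _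
      _ ≤ ‖A h‖ * (‖A‖ * ‖A h‖) := mul_le_mul_of_nonneg_left (A.le_opNorm _) (norm_nonneg _)
      _ = ‖A‖ * b := by rw [hb]; ring
  have key := hpos (h - t • A h)
  have hexp : ⟪h - t • A h, A (h - t • A h)⟫_ℝ = c - 2 * t * b + t ^ 2 * a := by
    rw [map_sub, map_smul, inner_sub_left, inner_sub_right, inner_sub_right, real_inner_smul_left, real_inner_smul_right, real_inner_smul_left,
      real_inner_smul_right, hAA, ← hc, ← ha, show ⟪A h, A h⟫_ℝ = b from real_inner_self_eq_norm_sq _]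
    ring
  rw [hexp] at key
  have h3 : t ^ 2 * a ≤ t * b := by
    calc t ^ 2 * a ≤ t ^ 2 * (‖A‖ * b) := mul_le_mul_of_nonneg_left hab (sq_nonneg _)
      _ = t * b := by rw [sq]; calc t * t * (‖A‖ * b) = t * (t * ‖A‖) * b := by ring
          _ = t * b := by rw [htA, mul_one]
  have h4 : t * b ≤ c := by linarith
  calc b = ‖A‖ * (t * b) := by rw [← mul_assoc, mul_comm ‖A‖ t, htA, one_mul]
    _ ≤ ‖A‖ * c := mul_le_mul_of_nonneg_left h4 (norm_nonneg _)

/-- **`⟪η, X η⟫ ≥ ‖T‖⁻¹ ‖η‖²`** (`η = Th`, `‖Th‖² ≤ ‖T‖⟪h, Th⟫`, `⟪η, Xη⟫ = ⟪h, Th⟫`). [cite: HeydenreichVanDerHofstad2017, Lemma 8.12] -/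
theorem inner_XOp_ge {p : unitInterval} {K : GPow k → ℝ} (hK : IsLaceKernel k p K) (hp : (p : ℝ) < pcR k) (hK1 : ∑' x, |K x| < 1)
    (η : lp (fun _ : GPow k => ℝ) 2) : ‖twoPointOp k p‖⁻¹ * ‖η‖ ^ 2 ≤ ⟪η, XOp k p K η⟫_ℝ := by
  set h := XOp k p K η with hh
  have hη : twoPointOp k p h = η := by rw [hh, ← mul_apply_eq_comp, twoPointOp_mul_XOp hK hp hK1, one_apply_eq_self]
  have hinner : ⟪η, XOp k p K η⟫_ℝ = ⟪h, twoPointOp k p h⟫_ℝ := by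
    rw [← hh]
    conv_lhs => rw [← hη]
    exact real_inner_comm _ _
  have hcs := norm_sq_le_norm_mul_inner (twoPointOp k p) (adjoint_twoPointOp hp) (inner_twoPointOp_nonneg hp) h
  by_cases hT : ‖twoPointOp k p‖ = 0
  · rw [hT, inv_zero, zero_mul]; exact inner_XOp_nonneg hK hp hK1 η
  have hTpos : 0 < ‖twoPointOp k p‖ := lt_of_le_of_ne (norm_nonneg _) (Ne.symm hT)
  rw [hinner, inv_mul_le_iff₀ hTpos]
  calc ‖η‖ ^ 2 = ‖twoPointOp k p h‖ ^ 2 := by rw [hη]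
    _ ≤ _ := hcs

/-! ## §4 (β4) `Ψ† = Ψ`: the lace kernel is inversion-symmetric -/

/-- `(Ψ⁻¹)† = Ψ⁻¹` (`Ψ⁻¹ = X + p·A`, both self-adjoint). [folklore] -/
theorem adjoint_inverse_PsiOp {p : unitInterval} {K : GPow k → ℝ} (hK : IsLaceKernel k p K) (hp : (p : ℝ) < pcR k) (hK1 : ∑' x, |K x| < 1) :
    ContinuousLinearMap.adjoint (Ring.inverse (PsiOp K)) = Ring.inverse (PsiOp K) := by
  have h : Ring.inverse (PsiOp K) = XOp k p K + (p : ℝ) • adjOp k := by rw [XOp, sub_add_cancel]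
  rw [h, map_add, map_smulₛₗ ContinuousLinearMap.adjoint, starRingEnd_apply, star_trivial, adjoint_XOp hK hp hK1, adjoint_adjOp]

/-- **`Ψ† = Ψ`** (the adjoint of `Ψ` is also a two-sided inverse of the self-adjoint `Ψ⁻¹`). [cite: HeydenreichVanDerHofstad2017, Lemma 8.11] -/
theorem adjoint_PsiOp {p : unitInterval} {K : GPow k → ℝ} (hK : IsLaceKernel k p K) (hp : (p : ℝ) < pcR k) (hK1 : ∑' x, |K x| < 1) :
    ContinuousLinearMap.adjoint (PsiOp K) = PsiOp K := by
  have hu := isUnit_PsiOp hK.summable_abs hK1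
  have hi := adjoint_inverse_PsiOp hK hp hK1
  have h1 : PsiOp K * Ring.inverse (PsiOp K) = 1 := Ring.mul_inverse_cancel _ hu
  have h2 : Ring.inverse (PsiOp K) * PsiOp K = 1 := Ring.inverse_mul_cancel _ hu
  -- adjoints of `h1`, `h2`: `Ψ⁻¹ Ψ† = 1`, `Ψ† Ψ⁻¹ = 1`
  have h1' : Ring.inverse (PsiOp K) * ContinuousLinearMap.adjoint (PsiOp K) = 1 := by
    have h := congrArg ContinuousLinearMap.adjoint h1
    rwa [adjoint_mul, hi, ContinuousLinearMap.adjoint_one] at h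
  calc ContinuousLinearMap.adjoint (PsiOp K) = (PsiOp K * Ring.inverse (PsiOp K)) * ContinuousLinearMap.adjoint (PsiOp K) := by rw [h1, one_mul]
    _ = PsiOp K * (Ring.inverse (PsiOp K) * ContinuousLinearMap.adjoint (PsiOp K)) := mul_assoc _ _ _
    _ = PsiOp K := by rw [h1', mul_one]

/-- **`ρ` is injective on `ℓ¹`** (read `a(g)` off `ρ(a) δ_g` at `1`). [folklore] -/
theorem kernelOp_injective {a b : GPow k → ℝ} (ha : Summable fun g => |a g|) (hb : Summable fun g => |b g|) (h : kernelOp a = kernelOp b) : a = b := by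
  funext g
  have h1 := kernelOp_single_apply ha 1 g
  have h2 := kernelOp_single_apply hb 1 g
  rw [inv_one, one_mul] at h1 h2
  rw [← h1, ← h2, h]

/-- **The lace kernel is inversion-symmetric: `K(x⁻¹) = K(x)`** whenever `‖K‖₁ < 1` (from `Ψ† = Ψ`, `ρ(K)† = ρ(Ǩ)` and injectivity; refuter (37.2)(i) / (U)).
[cite: HeydenreichVanDerHofstad2017, Lemma 8.11] -/
theorem IsLaceKernel.inv_symm {p : unitInterval} {K : GPow k → ℝ} (hK : IsLaceKernel k p K) (hp : (p : ℝ) < pcR k) (hK1 : ∑' x, |K x| < 1) (x : GPow k) :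
    K x⁻¹ = K x := by
  have hKs := hK.summable_abs
  have hKs' : Summable fun g => |K g⁻¹| := (Equiv.inv (GPow k)).summable_iff.2 hKs
  have h := adjoint_PsiOp hK hp hK1
  rw [PsiOp, map_add, ContinuousLinearMap.adjoint_one, adjoint_kernelOp hKs, add_right_inj] at h
  exact congr_fun (kernelOp_injective hKs' hKs h) x

end NcHaraSlade

end Grigorchuk

end Summit.CriticalPhenomena.PercolationContinuityZ3.Theorems.Transplant

end
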